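import Mathlib
import HarnessLib
import Summits.HubbardSuperconductivity.HubbardSuperconductivity.Theses.ChiralWindow
import Summits.HubbardSuperconductivity.HubbardSuperconductivity.Theorems.ChiralWindowCwChiralConstructionResidual
import Literature.MathematicalPhysics.QuantumLattice.DWaveOrderParameterProofs
import Literature.MathematicalPhysics.QuantumLattice.HubbardScaleReportCT

/-!
# STRATEGY CENSUS — Lean companion for crux `CwChiralConstruction` (stmt-HubbardSuperconductivity-1740)

Route `HubbardSuperconductivity/ChiralWindow`, rank-2 crux ("the programme"). Seat
`planner-cstrat-stmt-HubbardSuperconductivity-1740-p1` (crux-strategist, WALL-BREAKER on an exhausted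
chain, 2026-08-17). Prose census: `Cruxes/CwChiralConstruction/STRATEGY-CENSUS.md`; this file holds the
TYPED objects the census refers to, all kernel-checked (NO `sorry`):

* §R  `KLOrderOnFillingWindow` — the common residual of the four registered lines (verbatim the
  statement of `stub_klDWaveOrderOnFillingWindow`, `Lines/residual_kl_order.lean`) and
  `crux_of_residual` (= landed `cwChiralConstruction_of_orderOnFillingWindow`).
* §S  STRENGTHEN. `SourcedFloorOnFillingWindow` (S3: the positive-source, eventually-in-`L` floor that
  any construction outputs) with `residual_of_sourcedFloor`; hence `crux_of_sourcedFloor`. The refuted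
  strengthenings S1/S2 are the disprover's `cw1740_false_uniformFloor(On)`, `cw1740_false_powerFloor(On)`,
  `cw1740_false_withZeroCoupling` (`Cruxes/CwChiralConstruction/Disproof.lean` §D/§G, landed under
  `Theorems/CwChiralConstruction/Negative/`), cited not re-proved.
* §D2 DECOMPOSITION ALONG THE DECIDABLE INPUT. `KLDominanceOnFillingWindow` (certified numerics: B₁g is
  the isolated leading second-order Kohn–Luttinger channel on a free-filling window, margin `γU²`;
  a window-pinned variant of WeakCouplingBCS's support item `WcbcsKohnLuttingerB1g`, stmt-0158) and
  `KLUniversality` (the conditional constructive theorem "isolated B₁g dominance on a window ⇒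
  `exp(-C/U²)` floor there"); glue `residual_of_dominance_of_universality`, `crux_of_D2`.
* §D1 DECOMPOSITION ALONG RENORMALISATION SCALES, reusing the tree's a-posteriori certificate
  interface (`HubbardScaleData`, `hubbardScaleReportCT`): `WeakCouplingScaleEnclosure` (the ∀-small-`U`
  Bose–Fermi enclosure at ONE infrared scale, `m₀ ≥ 2e^{-C/U²}`, typed in the `μ - U/2` reading that
  the AposterioriOrderCriterionR lead's VERDICT-c1 prescribes) and `OrderCriterionRPrime` (route
  AposterioriCapRg's criterion R = stmt-13884 in its recommended repaired form (a) + `0 < numPatches`);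
  glue `residual_of_scaleEnclosure_of_criterion`, `crux_of_D1`.
* §M  MILESTONE (not a decomposition piece): `SourcedKLEnhancement` — the Kohn–Luttinger attraction made
  visible as an `O(1)` enhancement of the SOURCED pair response over the free gas at the exponentially
  small source scale `h₁ = exp(-C₁/U²)` ABOVE the gap scale; typable in the tree's own vocabulary,
  strictly weaker than the crux, does NOT compose to it (`top stair ≠ bottom stairs`,
  `le_dWaveOrderParameter_iff_forall`).
* §N  NEGATION target in typed form: `not_residual_iff`.

Nothing here is a new route item; the defs are census SIGNATURES. Which piece "remains the whole crux"
is argued in the prose census: `KLUniversality` (D2) and `WeakCouplingScaleEnclosure` (D1) respectively.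
-/

set_option linter.dupNamespace false
set_option linter.unusedVariables false

noncomputable section

namespace Summit.HubbardSuperconductivity.HubbardSuperconductivity.Cruxes.CwChiralConstruction.StrategyCensus

open Literature.MathematicalPhysics.QuantumLattice Filter
open Summit.HubbardSuperconductivity.HubbardSuperconductivity.Theses.ChiralWindow
open Summit.HubbardSuperconductivity.HubbardSuperconductivity.Theorems
open scoped Topology

/-! ## §R The residual (common core of every registered line) -/

/-- **The residual** `KLOrderOnFillingWindow`: Kohn–Luttinger `d_{x²-y²}` order at weak repulsion on a
hole-doped FREE-filling window, grand-canonical, Koma–Tasaki order parameter — verbatim the statement of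
the registered stub `stub_klDWaveOrderOnFillingWindow` of `Lines/residual_kl_order.lean`.
[conjectural step — the open constructive problem] -/
def KLOrderOnFillingWindow : Prop :=
  ∃ n₁ n₂ U₀ C : ℝ, 13 / 25 < n₁ ∧ n₁ < n₂ ∧ n₂ < 7 / 10 ∧ 0 < U₀ ∧ 0 < C ∧
    ∀ U ∈ Set.Ioo (0 : ℝ) U₀, ∀ μ : ℝ,
      KohnLuttinger.filling (squareDispersion 1 0) μ ∈ Set.Icc n₁ n₂ →
        Real.exp (-C / U ^ 2) ≤ dWaveOrderParameter U μ

/-- Residual ⇒ crux, BY NAME (landed frame `cwChiralConstruction_of_orderOnFillingWindow`: IVT for the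
continuous free filling + generic-`μ` interacting density). [folklore] -/
theorem crux_of_residual (h : KLOrderOnFillingWindow) : CwChiralConstruction :=
  cwChiralConstruction_of_orderOnFillingWindow h

/-! ## §S Strengthen -/

/-- **S3 — the positive-source, eventually-in-`L` floor** (what a completed multiscale construction
would literally output: for every small source `h` and all large `L`, the finite-volume sourced `d`-wave
density of `dWaveSourceTorus (L+1) U μ h` is `≥ exp(-C/U²)`, uniformly on the filling window). -/
def SourcedFloorOnFillingWindow : Prop :=
  ∃ n₁ n₂ U₀ C h₀ : ℝ, 13 / 25 < n₁ ∧ n₁ < n₂ ∧ n₂ < 7 / 10 ∧ 0 < U₀ ∧ 0 < C ∧ 0 < h₀ ∧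
    ∀ U ∈ Set.Ioo (0 : ℝ) U₀, ∀ μ : ℝ,
      KohnLuttinger.filling (squareDispersion 1 0) μ ∈ Set.Icc n₁ n₂ →
        ∀ h ∈ Set.Ioo (0 : ℝ) h₀, ∀ᶠ L : ℕ in atTop,
          Real.exp (-C / U ^ 2) ≤ dWaveSourceDensity (L + 1) U μ h

/-- S3 ⇒ residual: pure `liminf` bookkeeping (`le_liminf_of_le` with the a-priori bound
`dWaveSourceDensity ≤ B_d`, then the lower lever `le_dWaveOrderParameter_of_forall`). So S3 is a
STRENGTHENING of the residual and exposes no rigidity the residual lacks. [cite: KomaTasaki1994, §1] -/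
theorem residual_of_sourcedFloor (h : SourcedFloorOnFillingWindow) : KLOrderOnFillingWindow := by
  obtain ⟨n₁, n₂, U₀, C, h₀, hn₁, hn₁₂, hn₂, hU₀, hC, hh₀, H⟩ := h
  refine ⟨n₁, n₂, U₀, C, hn₁, hn₁₂, hn₂, hU₀, hC, fun U hU μ hμ => ?_⟩
  refine le_dWaveOrderParameter_of_forall U μ hh₀ fun h hh => ?_
  refine le_liminf_of_le ?_ (H U hU μ hμ h hh)
  exact isCoboundedUnder_ge_of_eventually_le _
    (x := 2 * ∑ e ∈ insert (0 : Literature.Probability.LatticeModels.Site 2) unitSteps,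
      |dWaveFormFactor e / Real.sqrt 2|)
    (Eventually.of_forall fun L => dWaveSourceDensity_le_const (L + 1) U μ h)

/-- S3 ⇒ crux. [folklore] -/
theorem crux_of_sourcedFloor (h : SourcedFloorOnFillingWindow) : CwChiralConstruction :=
  crux_of_residual (residual_of_sourcedFloor h)

/-! ## §D2 Decomposition along the decidable input (Kohn–Luttinger channel data) -/

/-- **D2, leaf 1 — `KLDominanceOnFillingWindow`** (certified interval arithmetic; decidable in kind):
on some free-filling window `[n₁, n₂] ⊂ (13/25, 7/10)` and for all small `U`, the B₁g channel bottom of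
the second-order Kohn–Luttinger vertex `U + U²χ₀(k+k')` on the Fermi curve of `squareDispersion 1 0` at
chemical potential `μ` lies below every other `D₄` channel by a margin `γU²`. A window-pinned variant of
`WcbcsKohnLuttingerB1g` (stmt-0158, whose `∃ a b ⊂ (0,1)` need not meet the crux's doping range); the
non-certified census j010500 (Disproof.lean §H) gives B₁g leading on `n ∈ [0.60, 0.80]` with a factor
`≥ 2` at `n ∈ [0.64, 0.70]`. [cite: RaghuKivelsonScalapino2010, §III Fig. 2] -/
def KLDominanceOnFillingWindow : Prop :=
  ∃ n₁ n₂ γ U₁ : ℝ, 13 / 25 < n₁ ∧ n₁ < n₂ ∧ n₂ < 7 / 10 ∧ 0 < γ ∧ 0 < U₁ ∧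
    ∀ U ∈ Set.Ioo (0 : ℝ) U₁, ∀ μ : ℝ,
      KohnLuttinger.filling (squareDispersion 1 0) μ ∈ Set.Icc n₁ n₂ →
        ∀ χ : D4Irrep, χ ≠ D4Irrep.B1g →
          channelInf (squareDispersion 1 0) μ U D4Irrep.B1g + γ * U ^ 2 ≤
            channelInf (squareDispersion 1 0) μ U χ

/-- **D2, leaf 2 — `KLUniversality`** (the conditional constructive theorem; "Kohn–Luttinger
superconductivity is asymptotically exact" in theorem form): WHENEVER B₁g is the isolated leading
second-order channel by `γU²` on a free-filling window inside `(13/25, 7/10)`, the Koma–Tasaki `d`-wave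
order parameter has a floor `exp(-C/U²)` on that window for all small `U`. This leaf is the programme
with its numerical input factored out — it remains crux-hard (census §Decomposition, D2).
[cite: RaghuKivelsonScalapino2010, §I ("asymptotically exact weak-coupling solution")] -/
def KLUniversality : Prop :=
  ∀ n₁ n₂ γ U₁ : ℝ, 13 / 25 < n₁ → n₁ < n₂ → n₂ < 7 / 10 → 0 < γ → 0 < U₁ →
    (∀ U ∈ Set.Ioo (0 : ℝ) U₁, ∀ μ : ℝ,
      KohnLuttinger.filling (squareDispersion 1 0) μ ∈ Set.Icc n₁ n₂ →
        ∀ χ : D4Irrep, χ ≠ D4Irrep.B1g →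
          channelInf (squareDispersion 1 0) μ U D4Irrep.B1g + γ * U ^ 2 ≤
            channelInf (squareDispersion 1 0) μ U χ) →
    ∃ U₀ C : ℝ, 0 < U₀ ∧ 0 < C ∧ ∀ U ∈ Set.Ioo (0 : ℝ) U₀, ∀ μ : ℝ,
      KohnLuttinger.filling (squareDispersion 1 0) μ ∈ Set.Icc n₁ n₂ →
        Real.exp (-C / U ^ 2) ≤ dWaveOrderParameter U μ

/-- D2 glue: dominance data + universality ⇒ residual. [folklore] -/
theorem residual_of_dominance_of_universality (hD : KLDominanceOnFillingWindow)
    (hU : KLUniversality) : KLOrderOnFillingWindow := by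
  obtain ⟨n₁, n₂, γ, U₁, hn₁, hn₁₂, hn₂, hγ, hU₁, H⟩ := hD
  obtain ⟨U₀, C, hU₀, hC, floor⟩ := hU n₁ n₂ γ U₁ hn₁ hn₁₂ hn₂ hγ hU₁ H
  exact ⟨n₁, n₂, U₀, C, hn₁, hn₁₂, hn₂, hU₀, hC, floor⟩

/-- D2 composed to the crux BY NAME. [folklore] -/
theorem crux_of_D2 (hD : KLDominanceOnFillingWindow) (hU : KLUniversality) : CwChiralConstruction :=
  crux_of_residual (residual_of_dominance_of_universality hD hU)

/-! ## §D1 Decomposition along renormalisation scales (a-posteriori certificate interface)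

The two-regime architecture of route AposterioriCapRg, transplanted from its fixed point `(U,δ)=(3,1/5)`
to the crux's `∀ U ∈ (0,U₀)`: a model-specific multiscale analysis producing ONE certified infrared
datum per `(U, μ)` (`WeakCouplingScaleEnclosure` — symmetric regime + explicit-phase Bose–Fermi
integration down to a FIXED scale `Λ₀(U)` below the gap, `h`-uniform only through the explicit phase
coordinate) and a universal criterion turning the datum into order (`OrderCriterionRPrime` — the
`h ↓ 0`, massless-Goldstone content). Both hypotheses are typed over `hubbardScaleReportCT U (μ - U/2)`:
the Grassmann objects behind the report realise the operator model `dWaveSourceTorus L U (μ + U/2) h`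
(symmetrised interaction; `Cruxes/AposterioriOrderCriterionR/VERDICT-c1.md` X1, after
Giuliani–Mastropietro 2010 (2.6a)), so the report read at `μ - U/2` is the one speaking about
chemical potential `μ`. -/

/-- **D1, leaf 1 — `WeakCouplingScaleEnclosure`**: for all rational thresholds there are a free-filling
window, `U₀`, `C` such that for every `U ∈ (0,U₀)` and `μ` in the window some scale datum `D` with
`0 < numPatches`, meeting the thresholds, with certified mean-field anomalous density
`m₀ ≥ 2·exp(-C/U²)`, is a certified enclosure of the countertermed scale report of the seeded torus for
every small seed `h` (from some `L₀(h)` on). The ∀-small-`U` analogue of AposterioriCapRg's C1+C2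
(stmt-14045 + stmt-14047). [conjectural step — open; census D1] -/
def WeakCouplingScaleEnclosure : Prop :=
  ∀ kStar etaStar : ℚ, 0 < kStar → 0 < etaStar →
    ∃ n₁ n₂ U₀ C : ℝ, 13 / 25 < n₁ ∧ n₁ < n₂ ∧ n₂ < 7 / 10 ∧ 0 < U₀ ∧ 0 < C ∧
      ∀ U ∈ Set.Ioo (0 : ℝ) U₀, ∀ μ : ℝ,
        KohnLuttinger.filling (squareDispersion 1 0) μ ∈ Set.Icc n₁ n₂ →
          ∃ h₀ : ℝ, 0 < h₀ ∧ ∃ D : HubbardScaleData,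
            D.MeetsThresholds kStar etaStar ∧ 0 < D.numPatches ∧
            2 * Real.exp (-C / U ^ 2) ≤ ((D.meanFieldDensity.fst : ℚ) : ℝ) ∧
            ∀ h ∈ Set.Ioc (0 : ℝ) h₀, ∃ L₀ : ℕ,
              D.IsCertifiedEnclosure (hubbardScaleReportCT U (μ - U / 2) D h) L₀

/-- **D1, leaf 2 — `OrderCriterionRPrime`**: route AposterioriCapRg's a-posteriori order criterion R
(stmt-13884 `AposterioriOrderCriterionR`) in the repaired form (a) of its line lead's VERDICT-c1 (report
read at `μ - U/2`; `0 < numPatches` closing the empty-shell escape X2). Universal in `(U, μ)`, hence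
SHARED between the fixed-point route and this weak-coupling crux. [conjectural step — open; no
a-posteriori criterion for gapless `U(1)` order is in print] -/
def OrderCriterionRPrime : Prop :=
  ∃ kStar etaStar : ℚ, 0 < kStar ∧ 0 < etaStar ∧
    ∀ (U μ h₀ : ℝ) (D : HubbardScaleData), 0 < h₀ → 0 < D.numPatches →
      (∀ h ∈ Set.Ioc (0 : ℝ) h₀, ∃ L₀ : ℕ,
        D.IsCertifiedEnclosure (hubbardScaleReportCT U (μ - U / 2) D h) L₀) →
      D.MeetsThresholds kStar etaStar →
        ((D.meanFieldDensity.fst : ℚ) : ℝ) / 2 ≤ dWaveOrderParameter U μ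

/-- D1 glue: enclosure + criterion ⇒ residual (pure logic: the criterion's thresholds are instantiated in
the enclosure, `exp(-C/U²) ≤ m₀/2 ≤ dWaveOrderParameter U μ`). [folklore] -/
theorem residual_of_scaleEnclosure_of_criterion (hW : WeakCouplingScaleEnclosure)
    (hR : OrderCriterionRPrime) : KLOrderOnFillingWindow := by
  obtain ⟨kStar, etaStar, hk, he, R⟩ := hR
  obtain ⟨n₁, n₂, U₀, C, hn₁, hn₁₂, hn₂, hU₀, hC, W⟩ := hW kStar etaStar hk he
  refine ⟨n₁, n₂, U₀, C, hn₁, hn₁₂, hn₂, hU₀, hC, fun U hU μ hμ => ?_⟩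
  obtain ⟨h₀, hh₀, D, hthr, hNp, hm₀, hencl⟩ := W U hU μ hμ
  have key := R U μ h₀ D hh₀ hNp hencl hthr
  linarith

/-- D1 composed to the crux BY NAME. [folklore] -/
theorem crux_of_D1 (hW : WeakCouplingScaleEnclosure) (hR : OrderCriterionRPrime) :
    CwChiralConstruction :=
  crux_of_residual (residual_of_scaleEnclosure_of_criterion hW hR)

/-! ## §M Milestone (strictly weaker than the crux; does not compose to it) -/

/-- **`SourcedKLEnhancement`** — the normal-phase half of the programme in the tree's own vocabulary:
at the exponentially small source scale `h₁(U) = exp(-C₁/U²)` ABOVE the gap scale, the `L → ∞` sourced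
`d`-wave density of the interacting torus exceeds that of the FREE gas (`U = 0`) by a `U`-independent
factor `1 + κ` on a filling window (ladder heuristics: `F ≈ F₀/(1 - aρC₁)` with `λ_{B1g} = -aU²`, so the
enhancement is `O(1)` exactly when the net second-order B₁g vertex is attractive, `a > 0`). This is what
a sign-resolved symmetric-regime expansion down to scale `h₁` would prove (barrier
`WeakCouplingCeilingNarrow`: a theorem in `d = 1`, Mastropietro 2008 Thm 13.1; OPEN in `d = 2`). By the
staircase (`le_dWaveOrderParameter_iff_forall`) a floor on this TOP stair implies nothing about the order
parameter: milestone, not decomposition. [conjectural step — open, but in the symmetric regime] -/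
def SourcedKLEnhancement : Prop :=
  ∃ n₁ n₂ U₀ C₁ κ : ℝ, 13 / 25 < n₁ ∧ n₁ < n₂ ∧ n₂ < 7 / 10 ∧ 0 < U₀ ∧ 0 < C₁ ∧ 0 < κ ∧
    ∀ U ∈ Set.Ioo (0 : ℝ) U₀, ∀ μ : ℝ,
      KohnLuttinger.filling (squareDispersion 1 0) μ ∈ Set.Icc n₁ n₂ →
        (1 + κ) * liminf (fun L : ℕ => dWaveSourceDensity (L + 1) 0 μ (Real.exp (-C₁ / U ^ 2))) atTop ≤
          liminf (fun L : ℕ => dWaveSourceDensity (L + 1) U μ (Real.exp (-C₁ / U ^ 2))) atTop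

/-! ## §N Negation target, typed -/

/-- What a refutation of the residual must produce: for EVERY candidate window, threshold and constant,
a coupling below the threshold and a `μ` in the window where the order parameter is `< exp(-C/U²)` —
i.e. a proof that weakly repulsive 2D Hubbard fermions have (essentially) NO `d_{x²-y²}` order at some
filling of every sub-window of `(13/25, 7/10)`: the negation of Kohn–Luttinger folklore where the census
has B₁g leading (Disproof.lean §E, §H). [folklore] -/
theorem not_residual_iff :
    ¬ KLOrderOnFillingWindow ↔
      ∀ n₁ n₂ U₀ C : ℝ, 13 / 25 < n₁ → n₁ < n₂ → n₂ < 7 / 10 → 0 < U₀ → 0 < C →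
        ∃ U ∈ Set.Ioo (0 : ℝ) U₀, ∃ μ : ℝ,
          KohnLuttinger.filling (squareDispersion 1 0) μ ∈ Set.Icc n₁ n₂ ∧
            dWaveOrderParameter U μ < Real.exp (-C / U ^ 2) := by
  unfold KLOrderOnFillingWindow
  push Not
  rfl

end Summit.HubbardSuperconductivity.HubbardSuperconductivity.Cruxes.CwChiralConstruction.StrategyCensus

end
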